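/-
Copyright (c) 2026. All rights reserved.
Released under Apache 2.0 license as described in the file LICENSE.
Authors: abc-iut cell, campaign-S prover seat abc-iut-S8 (wave 2).
-/
import Mathlib.LinearAlgebra.PiTensorProduct.Basis
import Literature.IUT.LogVolume.TensorPacketVolume
import Literature.IUT.LogVolume.LogRadiusBounds
import Literature.IUT.LogVolume.UnitLogVolume
import HarnessLib

/-!
# [IUTchIV] Proposition 1.4 (iii), (iv): nonarchimedean normalised log-volume ESTIMATES (typed; (iii)
# second inequality, "Moreover", and (iv) proved)

Mochizuki, *Inter-universal Teichmüller theory IV*, RIMS manuscript (Apr. 2020; = PRIMS **57** (2021)),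
§1, Proposition 1.4, kurims p. 13 (notation of Props. 1.1, 1.2: `|I| ≥ 2`, `e_i`, `d_I`, `a_I`, `b_I`,
`(R_I)^∼`, `log_p(R_I^×)`, `φ` an automorphism of `log_p(R_I^×) ⊗ ℚ_p` inducing an automorphism of
`log_p(R_I^×)`, and the log-volume `μ^log` of (i)):

  **(iii)** "Let `I* ⊆ I` be a subset such that for each `i ∈ I ∖ I*`, it holds that `p − 2 ≥ e_i (≥ 1)`.
  Then for any `λ ∈ (1/e_{i†})·ℤ`, `i† ∈ I`, we have inclusions
  `φ(p^λ·(R_I)^∼) ⊆ p^{⌊λ−d_I−a_I⌋}·log_p(R_I^×) ⊆ p^{⌊λ−d_I−a_I⌋−b_I}·(R_I)^∼` and inequalities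
  `μ^log(p^{⌊λ−d_I−a_I⌋}·log_p(R_I^×)) ≤ {−λ + d_I + 1 + 4·|I*|/p}·log(p)`;
  `μ^log(p^{⌊λ−d_I−a_I⌋−b_I}·(R_I)^∼) ≤ {−λ + d_I + 1}·log(p) + Σ_{i∈I*} {3 + log(e_i)}`
  — where we write "`|(−)|`" for the cardinality of the set "`(−)`". Moreover, `d_I + a_I ≥ |I|` if
  `p > 2`; `d_I + a_I ≥ 2·|I|` if `p = 2`."
  **(iv)** "If `p > 2` and `e_i = 1` for all `i ∈ I`, then `φ((R_I)^∼) ⊆ (R_I)^∼`, and `μ^log((R_I)^∼) = 0`."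

## Typing (over `TensorPacketRing.lean`, abc-iut-S1, and `TensorPacketVolume.lean`)

The INCLUSIONS of (iii) are, verbatim, those of Prop. 1.2 (ii) (printed proof: "The inclusions of
assertion (iii) follow immediately from Proposition 1.2, (ii)"): they are the cell's `Prop12ii p k` and
are not re-typed.  The log-volume is `packetLogVolume p k L ψ` (the `∏ O_{L_j}`-normalised, degree-weighted
log-volume through a decomposition `ψ : V ≃ Π_j L_j`); "`p^{⌊λ−d_I−a_I⌋−b_I}·(R_I)^∼`" is realised, exactly
as in `Prop12ii`, as `(p^n·⊗h_i)·(R_I)^∼` with `n = ⌊λ−d_I−a_I⌋` and `‖h_i‖ = p^{b_i}` (`RealizesNegB`);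
`λ = m/e_{i†}`.  So: `Prop14iii₁` (first inequality), `Prop14iii₂` (second inequality), `Prop14iii₃`
("Moreover"), `Prop14iii := Prop12ii ∧ Prop14iii₁ ∧ Prop14iii₂ ∧ Prop14iii₃`; `Prop14iv` ((iv), both
clauses).

## Proved here

* `Prop14iii₂_holds` — the **second inequality**, unconditionally: by `TensorPacketVolume`
  `μ^log((p^n·⊗h_i)·(R_I)^∼) = (−n + b_I)·log(p)`, then `−n ≤ −(λ−d_I−a_I) + 1` and
  `(a_I + b_I)·log(p) ≤ Σ_{i∈I*}{3 + log(e_i)}` (`LogRadiusBounds.sum_logRadius_mul_log_le`) — the printed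
  computation "`≤ {−λ + d_I + a_I + b_I + 1}·log(p) ≤ {−λ + d_I + 1}·log(p) + Σ_{i∈I*}{3 + log(e_i)}`".
* `prop14iii₃_of_different_bound` — "Moreover" from the different bound `d_i ≥ (e_i − 1)/e_i`
  ("[cf. Proposition 1.3, (i)]", `Prop13i`, discharged by the `DifferentEstimates` companions) and
  `d_i ≥ 0`; `LogRadiusBounds.card_le_sum_add_logRadiusA` / `two_mul_card_le_sum_add_logRadiusA_two`.
* `prop14iv_of_prop12iv` — (iv) from its inclusion clause `Prop12iv` (S1; proof by the S5 companion) and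
  the normalisation `μ^log((R_I)^∼) = 0` (`packetLogVolume_normalizedPacket`), which holds outright.
* The Step (v) interface (`packetLogVolume_le_of_subset_translate`): any subset of
  `p^{⌊λ−d_I−a_I⌋−b_I}·(R_I)^∼` of positive volume obeys the second bound (monotonicity of `μ^log`;
  the translate is the hull set `∏_j ψ(g)_j·O_{L_j}`, `image_smul_normalizedPacket_eq_hullSet`).
* `Prop14iii₁_of_logPacket_volume` — the first inequality REDUCED to two statements about the intrinsic
  Haar measure of `V` (the `p`-scaling of `μ^log` and the identity `μ^log(log_p(R_I^×)) = Σ_i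
  μ^log(log_p(R_i^×)) + μ^log(R_I)` of the printed proof, abc-iut-S7's `TensorPacketHaar` /
  `TensorPacketLattice`) using Prop. 1.4 (ii) per factor (`UnitLogVolume`) and
  `LogRadiusBounds.logVolume_bound_one`.
Nothing here bears on the disputed [IUTchIII] Cor. 3.12.
-/

noncomputable section

open MeasureTheory Set Metric Finset
open scoped NormedField Pointwise

namespace Literature.IUT.LogVolume

variable (p : ℕ) [Fact p.Prime]
variable {I : Type} [Fintype I] [DecidableEq I]
variable (k : I → Type) [∀ i, NontriviallyNormedField (k i)] [∀ i, NormedAlgebra ℚ_[p] (k i)]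
  [∀ i, IsUltrametricDist (k i)] [∀ i, ProperSpace (k i)]
variable {J : Type} [Fintype J] (L : J → Type) [∀ j, NontriviallyNormedField (L j)]
  [∀ j, NormedAlgebra ℚ_[p] (L j)] [∀ j, IsUltrametricDist (L j)] [∀ j, ProperSpace (L j)]
  [∀ j, MeasurableSpace (L j)] [∀ j, BorelSpace (L j)]
variable (ψ : PacketAlgebra p k ≃ₐ[ℚ_[p]] (Π j, L j))

/-! ## The statements -/

/-- **[IUTchIV] Prop. 1.4 (iii), first displayed inequality** (p. 13): for `I* ⊆ I` with `e_i ≤ p − 2` off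
`I*`, `i† ∈ I`, `λ = m/e_{i†}`, `n = ⌊λ − d_I − a_I⌋`:
"`μ^log(p^{⌊λ−d_I−a_I⌋}·log_p(R_I^×)) ≤ {−λ + d_I + 1 + 4·|I*|/p}·log(p)`".
[cite: Mochizuki2012, IUTchIV Prop. 1.4 (iii) p. 13] -/
def Prop14iii₁ : Prop :=
  2 ≤ Fintype.card I →
    ∀ (Istar : Finset I), (∀ i, i ∉ Istar → absRamificationIdx p (k i) ≤ p - 2) →
      ∀ (i : I) (m : ℤ),
        letI lam : ℝ := (m : ℝ) / absRamificationIdx p (k i)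
        letI n : ℤ := ⌊lam - dSum p k - aSum p k⌋
        packetLogVolume p k L ψ (ppow p k n • (logPacket p k : Set (PacketAlgebra p k)))
          ≤ (-lam + dSum p k + 1 + 4 * (Istar.card : ℝ) / p) * Real.log p

/-- **[IUTchIV] Prop. 1.4 (iii), second displayed inequality** (p. 13), with "`p^{⌊λ−d_I−a_I⌋−b_I}·(R_I)^∼`"
realised as in `Prop12ii` by `(p^n·⊗h_i)·(R_I)^∼`, `‖h_i‖ = p^{b_i}`:
"`μ^log(p^{⌊λ−d_I−a_I⌋−b_I}·(R_I)^∼) ≤ {−λ + d_I + 1}·log(p) + Σ_{i∈I*} {3 + log(e_i)}`".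
[cite: Mochizuki2012, IUTchIV Prop. 1.4 (iii) p. 13] -/
def Prop14iii₂ : Prop :=
  2 ≤ Fintype.card I →
    ∀ (Istar : Finset I), (∀ i, i ∉ Istar → absRamificationIdx p (k i) ≤ p - 2) →
      ∀ (i : I) (m : ℤ) (h : Π i, k i), RealizesNegB p k h →
        letI lam : ℝ := (m : ℝ) / absRamificationIdx p (k i)
        letI n : ℤ := ⌊lam - dSum p k - aSum p k⌋
        packetLogVolume p k L ψ
            ((ppow p k n * purePacket p k h) • (normalizedPacket p k : Set (PacketAlgebra p k)))
          ≤ (-lam + dSum p k + 1) * Real.log p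
              + ∑ i ∈ Istar, (3 + Real.log (absRamificationIdx p (k i)))

omit [DecidableEq I] in
/-- **[IUTchIV] Prop. 1.4 (iii), "Moreover"** (p. 13): "`d_I + a_I ≥ |I|` if `p > 2`; `d_I + a_I ≥ 2·|I|`
if `p = 2`." [cite: Mochizuki2012, IUTchIV Prop. 1.4 (iii) p. 13] -/
def Prop14iii₃ : Prop :=
  (2 < p → (Fintype.card I : ℝ) ≤ dSum p k + aSum p k) ∧
    (p = 2 → 2 * (Fintype.card I : ℝ) ≤ dSum p k + aSum p k)

/-- **[IUTchIV] Prop. 1.4 (iii)** (p. 13) in full: the inclusions (= `Prop12ii`, "follow immediately from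
Proposition 1.2, (ii)"), the two inequalities, and "Moreover".
[cite: Mochizuki2012, IUTchIV Prop. 1.4 (iii) p. 13] -/
def Prop14iii : Prop :=
  Prop12ii p k ∧ Prop14iii₁ p k L ψ ∧ Prop14iii₂ p k L ψ ∧ Prop14iii₃ p k

/-- **[IUTchIV] Prop. 1.4 (iv)** (p. 13): "If `p > 2` and `e_i = 1` for all `i ∈ I`, then
`φ((R_I)^∼) ⊆ (R_I)^∼`, and `μ^log((R_I)^∼) = 0`." (The inclusion clause is the conclusion of
`Prop12iv`.) [cite: Mochizuki2012, IUTchIV Prop. 1.4 (iv) p. 13] -/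
def Prop14iv : Prop :=
  2 ≤ Fintype.card I → 2 < p → (∀ i, absRamificationIdx p (k i) = 1) →
    (∀ (φ : PacketAlgebra p k ≃ₗ[ℚ_[p]] PacketAlgebra p k), IsLogPacketAut p k φ →
        φ '' (normalizedPacket p k : Set (PacketAlgebra p k)) ⊆ normalizedPacket p k) ∧
      packetLogVolume p k L ψ (normalizedPacket p k) = 0

/-! ## Proofs -/

omit [Fintype I] [DecidableEq I] in
/-- A family realising `p^{−b_I}` has `log ‖h_i‖ = b_i·log(p)` and nonzero entries.
[claim: Mochizuki2012, status: disputed] -/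
theorem RealizesNegB.log_norm {h : Π i, k i} (hh : RealizesNegB p k h) (i : I) :
    h i ≠ 0 ∧ Real.log ‖h i‖ = logRadiusB p (absRamificationIdx p (k i)) * Real.log p := by
  have hp0 : (0 : ℝ) < p := by exact_mod_cast (Fact.out : p.Prime).pos
  have hn := hh i
  refine ⟨norm_pos_iff.mp (by rw [hn]; exact Real.rpow_pos_of_pos hp0 _), ?_⟩
  rw [hn, Real.log_rpow hp0]

omit [DecidableEq I] in
/-- `|I| ≥ 2 ⇒ I ≠ ∅`. [folklore] -/
private theorem nonempty_of_two_le (hI : 2 ≤ Fintype.card I) : Nonempty I :=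
  Fintype.card_pos_iff.mp (by omega)

omit [DecidableEq I] [∀ i, IsUltrametricDist (k i)] [∀ i, ProperSpace (k i)] in
/-- `V = ⊗_{ℚ_p} k_i ≠ 0` (the tensor basis is indexed by a nonempty type). [folklore] -/
private theorem nontrivial_packetAlgebra : Nontrivial (PacketAlgebra p k) := by
  let b : ∀ i, Module.Basis (Module.Free.ChooseBasisIndex ℚ_[p] (k i)) ℚ_[p] (k i) :=
    fun i ↦ Module.Free.chooseBasis ℚ_[p] (k i)
  let B := Basis.piTensorProduct b
  haveI : ∀ i, Nonempty (Module.Free.ChooseBasisIndex ℚ_[p] (k i)) := fun i ↦ (b i).index_nonempty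
  obtain ⟨q⟩ : Nonempty (∀ i, Module.Free.ChooseBasisIndex ℚ_[p] (k i)) := inferInstance
  exact ⟨⟨B q, 0, B.ne_zero q⟩⟩

omit [DecidableEq I] [∀ i, IsUltrametricDist (k i)] [∀ i, ProperSpace (k i)] [Fintype J]
  [∀ j, IsUltrametricDist (L j)] [∀ j, ProperSpace (L j)] [∀ j, MeasurableSpace (L j)]
  [∀ j, BorelSpace (L j)] in
include ψ in
/-- A decomposition `V ≃ ∏_j L_j` has at least one factor (`V ≠ 0`). [folklore] -/
private theorem nonempty_index : Nonempty J := by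
  haveI := nontrivial_packetAlgebra p k
  by_contra hJ
  rw [not_nonempty_iff] at hJ
  have h01 : (0 : PacketAlgebra p k) = 1 := ψ.injective (Subsingleton.elim _ _)
  exact zero_ne_one h01

/-- **Prop. 1.4 (iii), second inequality, PROVED**: `μ^log((p^n·⊗h_i)·(R_I)^∼) = (−n + b_I)·log(p)
≤ {−λ + d_I + a_I + b_I + 1}·log(p) ≤ {−λ + d_I + 1}·log(p) + Σ_{i∈I*}{3 + log(e_i)}` (proof p. 14).
[cite: Mochizuki2012, IUTchIV Prop. 1.4 (iii) p. 13] -/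
theorem Prop14iii₂_holds : Prop14iii₂ p k L ψ := by
  intro hI Istar htame i m h hh
  haveI := nonempty_of_two_le hI
  haveI : Nonempty J := nonempty_index p k L ψ
  have hp : p.Prime := Fact.out
  have hlogp : 0 ≤ Real.log p := Real.log_nonneg (by exact_mod_cast hp.one_lt.le)
  set lam : ℝ := (m : ℝ) / absRamificationIdx p (k i) with hlam
  set n : ℤ := ⌊lam - dSum p k - aSum p k⌋ with hn
  have hh0 : ∀ i, h i ≠ 0 := fun i ↦ (RealizesNegB.log_norm p k hh i).1
  have hvol := packetLogVolume_ppow_mul_purePacket_smul p k L ψ n h hh0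
  simp only [fun i ↦ (RealizesNegB.log_norm p k hh i).2] at hvol
  rw [hvol, ← Finset.sum_mul]
  -- `-n ≤ -(lam - d_I - a_I) + 1`
  have hfloor : -(n : ℝ) ≤ -(lam - dSum p k - aSum p k) + 1 := by
    have := Int.lt_floor_add_one (lam - dSum p k - aSum p k)
    rw [← hn] at this
    linarith
  have h1 : -(n * Real.log p) ≤ (-(lam - dSum p k - aSum p k) + 1) * Real.log p := by
    rw [← neg_mul]
    exact mul_le_mul_of_nonneg_right hfloor hlogp
  -- `(a_I + b_I) log p ≤ Σ_{I*} (3 + log e_i)`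
  have h2 := sum_logRadius_mul_log_le Finset.univ Istar (fun i ↦ absRamificationIdx p (k i)) hp
    (fun i _ ↦ absRamificationIdx_pos p (k i)) (Finset.subset_univ _)
    (fun i _ hi ↦ htame i hi)
  rw [Finset.sum_add_distrib] at h2
  have haI : aSum p k = ∑ i, logRadiusA p (absRamificationIdx p (k i)) := rfl
  have hbI : bSum p k = ∑ i, logRadiusB p (absRamificationIdx p (k i)) := rfl
  rw [← haI, ← hbI] at h2
  rw [← hbI]
  calc -(n * Real.log p) + bSum p k * Real.log p
      ≤ (-(lam - dSum p k - aSum p k) + 1) * Real.log p + bSum p k * Real.log p := by gcongr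
    _ = (-lam + dSum p k + 1) * Real.log p + (aSum p k + bSum p k) * Real.log p := by ring
    _ ≤ (-lam + dSum p k + 1) * Real.log p
          + ∑ i ∈ Istar, (3 + Real.log (absRamificationIdx p (k i))) := add_le_add le_rfl h2

omit [DecidableEq I] in
/-- **Prop. 1.4 (iii), "Moreover", from the different bound**: if `d_i ≥ (e_i − 1)/e_i` for all `i`
("since `d_i ≥ (e_i − 1)/e_i` for all `i ∈ I` [cf. Proposition 1.3, (i)]", proof p. 14 — the case
`k_0 = ℚ_p` of `Prop13i`) then `d_I + a_I ≥ |I|` (`p > 2`) and `d_I + a_I ≥ 2|I|` (`p = 2`, using `d_i ≥ 0`).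
[cite: Mochizuki2012, IUTchIV Prop. 1.4 (iii) p. 13] -/
theorem prop14iii₃_of_different_bound
    (hd : ∀ i, (((absRamificationIdx p (k i) : ℕ) : ℝ) - 1) / (absRamificationIdx p (k i) : ℕ)
      ≤ differentOrd p (k i)) :
    Prop14iii₃ p k := by
  have hp : p.Prime := Fact.out
  have hsum : dSum p k + aSum p k
      = ∑ i, (differentOrd p (k i) + logRadiusA p (absRamificationIdx p (k i))) := by
    rw [dSum, aSum, ← Finset.sum_add_distrib]
  constructor
  · intro _
    rw [hsum]
    have := card_le_sum_add_logRadiusA Finset.univ (fun i ↦ absRamificationIdx p (k i)) hp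
      (fun i _ ↦ absRamificationIdx_pos p (k i)) (fun i ↦ differentOrd p (k i)) (fun i _ ↦ hd i)
    simpa using this
  · intro hp2
    rw [hsum]
    have h2 : ∀ i, (2 : ℝ) ≤ differentOrd p (k i) + logRadiusA p (absRamificationIdx p (k i)) := by
      intro i
      rw [logRadiusA, if_pos hp2]
      have := differentOrd_nonneg p (k i)
      linarith
    calc 2 * (Fintype.card I : ℝ) = ∑ _i : I, (2 : ℝ) := by simp [mul_comm]
      _ ≤ _ := Finset.sum_le_sum fun i _ ↦ h2 i

/-- **Prop. 1.4 (iv) from its inclusion clause**: `Prop12iv` (Prop. 1.2 (iv), abc-iut-S1; proved by the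
Prop. 1.2 companions) gives `φ((R_I)^∼) ⊆ (R_I)^∼`, and `μ^log((R_I)^∼) = 0` is the normalisation
(`packetLogVolume_normalizedPacket`). [cite: Mochizuki2012, IUTchIV Prop. 1.4 (iv) p. 13] -/
theorem prop14iv_of_prop12iv (h12 : Prop12iv p k) : Prop14iv p k L ψ := by
  intro hI hp2 he
  haveI := nonempty_of_two_le hI
  exact ⟨fun φ hφ ↦ h12 hI hp2 he φ hφ, packetLogVolume_normalizedPacket p k L ψ⟩

/-- The volume clause of (iv) holds outright (no hypothesis on `p` or `e_i`): `μ^log((R_I)^∼) = 0`.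
[cite: Mochizuki2012, IUTchIV Prop. 1.4 (iv) p. 13] -/
theorem prop14iv_volume (hI : 2 ≤ Fintype.card I) : packetLogVolume p k L ψ (normalizedPacket p k) = 0 := by
  haveI := nonempty_of_two_le hI
  exact packetLogVolume_normalizedPacket p k L ψ

/-! ## Consequences for subsets: the interface to [IUTchIV] Thm. 1.10, Step (v)

Step (v) of the proof of Thm. 1.10 (kurims pp. 27–28) bounds "the component of the log-volume of the
holomorphic hull" of a set by "computing an upper bound for the log-volume of the right-hand side of the
inclusion `p^{⌊λ−d_I−a_I⌋}·log_p(R_I^×) ⊆ p^{⌊λ−d_I−a_I⌋−b_I}·(R_I)^∼` of Proposition 1.4, (iii)": a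
set contained in that right-hand side has log-volume at most the second displayed bound.  The
right-hand side is a hull set `∏_j ψ(g)_j·O_{L_j}` of the decomposition (hence its own holomorphic hull),
of positive finite volume. -/

section Subsets

omit [∀ i, IsUltrametricDist (k i)] [∀ i, ProperSpace (k i)] [∀ j, MeasurableSpace (L j)]
  [∀ j, BorelSpace (L j)] in
/-- `ψ(g·(R_I)^∼)` is the hull set `∏_j ψ(g)_j·O_{L_j}` (all `ψ(g)_j ≠ 0`).
[cite: Mochizuki2012, IUTchIV Prop. 1.4 (iii) proof p. 14] -/
theorem image_smul_normalizedPacket_eq_hullSet [Nonempty I] [∀ i, IsUltrametricDist (k i)]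
    [∀ i, ProperSpace (k i)] (g : PacketAlgebra p k) (hg : ∀ j, ψ g j ≠ 0) :
    ψ '' (g • (normalizedPacket p k : Set (PacketAlgebra p k))) = hullSet L (ψ g) := by
  rw [hullSet_eq_image_mul L (ψ g) hg, ← image_normalizedPacket p k L ψ, ← Set.image_smul, image_image,
    image_image]
  exact image_congr fun a _ ↦ by rw [smul_eq_mul, map_mul]

/-- The translates `g·(R_I)^∼` have positive … [cite: Mochizuki2012, IUTchIV Prop. 1.4 (i) p. 13] -/
theorem haar_image_smul_normalizedPacket_pos [Nonempty I] (g : PacketAlgebra p k)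
    (hg : ∀ j, ψ g j ≠ 0) :
    0 < (piUnitBallStructure L).haar (ψ '' (g • (normalizedPacket p k : Set (PacketAlgebra p k)))) := by
  rw [image_smul_normalizedPacket_eq_hullSet p k L ψ g hg]
  exact (isDirectProductRegion_hullSet L (ψ g) hg).haar_pi_pos

/-- … and finite volume. [cite: Mochizuki2012, IUTchIV Prop. 1.4 (i) p. 13] -/
theorem haar_image_smul_normalizedPacket_lt_top [Nonempty I] (g : PacketAlgebra p k)
    (hg : ∀ j, ψ g j ≠ 0) :
    (piUnitBallStructure L).haar (ψ '' (g • (normalizedPacket p k : Set (PacketAlgebra p k)))) < ⊤ := by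
  rw [image_smul_normalizedPacket_eq_hullSet p k L ψ g hg]
  exact (isDirectProductRegion_hullSet L (ψ g) hg).haar_pi_lt_top

omit [Fintype I] [DecidableEq I] [∀ i, IsUltrametricDist (k i)] [∀ i, ProperSpace (k i)] in
/-- **Monotonicity of `μ^log`** for subsets of positive, resp. finite, volume.
[cite: Mochizuki2012, IUTchIV Prop. 1.4 (i) p. 13] -/
theorem packetLogVolume_mono {A B : Set (PacketAlgebra p k)}
    (hA : 0 < (piUnitBallStructure L).haar (ψ '' A)) (hB : (piUnitBallStructure L).haar (ψ '' B) < ⊤)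
    (h : A ⊆ B) : packetLogVolume p k L ψ A ≤ packetLogVolume p k L ψ B :=
  (piUnitBallStructure L).normalizedLogVolume_mono _ hA hB (image_mono h)

/-- **Step (v) form of Prop. 1.4 (iii)**: every subset `U ⊆ p^{⌊λ−d_I−a_I⌋−b_I}·(R_I)^∼` of positive
volume (e.g. the holomorphic hull of a union of images contained in that module, Thm. 1.10 Step (v),
pp. 27–28) satisfies `μ^log(U) ≤ {−λ + d_I + 1}·log(p) + Σ_{i∈I*}{3 + log(e_i)}`.
[cite: Mochizuki2012, IUTchIV Thm. 1.10 proof Step (v) p. 28] -/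
theorem packetLogVolume_le_of_subset_translate (hI : 2 ≤ Fintype.card I)
    (Istar : Finset I) (htame : ∀ i, i ∉ Istar → absRamificationIdx p (k i) ≤ p - 2)
    (i : I) (m : ℤ) (h : Π i, k i) (hh : RealizesNegB p k h) {U : Set (PacketAlgebra p k)}
    (hU : U ⊆ (ppow p k ⌊(m : ℝ) / absRamificationIdx p (k i) - dSum p k - aSum p k⌋ * purePacket p k h)
        • (normalizedPacket p k : Set (PacketAlgebra p k)))
    (hUpos : 0 < (piUnitBallStructure L).haar (ψ '' U)) :
    packetLogVolume p k L ψ U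
      ≤ (-((m : ℝ) / absRamificationIdx p (k i)) + dSum p k + 1) * Real.log p
          + ∑ i ∈ Istar, (3 + Real.log (absRamificationIdx p (k i))) := by
  haveI := nonempty_of_two_le hI
  have hh0 : ∀ i, h i ≠ 0 := fun i ↦ (RealizesNegB.log_norm p k hh i).1
  set g := ppow p k ⌊(m : ℝ) / absRamificationIdx p (k i) - dSum p k - aSum p k⌋ * purePacket p k h
  have hg : ∀ j, ψ g j ≠ 0 := fun j ↦ by
    have hp0 : (0 : ℝ) < p := by exact_mod_cast (Fact.out : p.Prime).pos
    rw [← norm_pos_iff, map_mul, Pi.mul_apply, norm_mul, norm_psi_ppow_apply, psi_purePacket_apply,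
      norm_prod]
    refine mul_pos (zpow_pos hp0 _) (Finset.prod_pos fun i _ ↦ ?_)
    rw [norm_factorEmb]
    exact norm_pos_iff.mpr (hh0 i)
  exact (packetLogVolume_mono p k L ψ hUpos (haar_image_smul_normalizedPacket_lt_top p k L ψ g hg) hU).trans
    (Prop14iii₂_holds p k L ψ hI Istar htame i m h hh)

end Subsets

/-! ## The first inequality, reduced to the volume of `log_p(R_I^×)`

The printed proof of the first displayed inequality (p. 14), verbatim: "`μ^log(p^{⌊λ−d_I−a_I⌋}·log_p(R_I^×))
≤ {−λ + d_I + a_I + 1}·log(p) + μ^log(log_p(R_I^×)) = {−λ + d_I + a_I + 1}·log(p) + Σ_{i∈I} μ^log(log_p(R_i^×)) +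
μ^log(R_I) ≤ {−λ + d_I + 1 + Σ_{i∈I}(a_i − 1/e_i)}·log(p) ≤ {−λ + d_I + 1 + 4·|I*|/p}·log(p)`", using
"by assertion (i), `μ^log(R_I) ≤ μ^log((R_I)^∼) = 0`; by assertion (ii), `μ^log(log_p(R_i^×)) ≤
−(1/e_i)·log(p)`".  [In the first two segments this file works with the exact-scaling form
`{−⌊λ−d_I−a_I⌋}·log(p)` in place of print's `{−λ + d_I + a_I + 1}·log(p)`: that is what the scaling
hypothesis `hscale` below delivers, and `−⌊x⌋ ≤ −x + 1` recovers the printed segments, so nothing weaker than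
print is used — annotation added per referee PASS-B10 advisory B10-1, the quotation above is now print-verbatim.]
Assertion (ii) per factor is `UnitLogVolume.normalizedLocalLogVolume_logUnits_le`;
the real arithmetic is `LogRadiusBounds.logVolume_bound_one`.  The two remaining inputs — the scaling
`μ^log(p^n·A) = −n·log(p) + μ^log(A)` on `V` and the identity `μ^log(log_p(R_I^×)) = Σ_i
μ^log(log_p(R_i^×)) + μ^log(R_I)` (Haar measure of a tensor product of lattices) — are statements about
the intrinsic Haar measure of `V` (`TensorPacketHaar.lean` / `TensorPacketLattice.lean`, abc-iut-S7) and
enter here as hypotheses. -/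

section FirstInequality

omit [DecidableEq I] in
/-- **Prop. 1.4 (iii), first inequality, from the volume of `log_p(R_I^×)`**: given the `p`-power
scaling of `μ^log` on `log_p(R_I^×)`, the identity `μ^log(log_p(R_I^×)) = Σ_i μ^log(log_p(R_i^×)) +
μ^log(R_I)` (per-factor log-volumes normalised by `e_i f_i = [k_i : ℚ_p]`) and `μ^log(R_I) ≤ 0`, the
first displayed inequality of (iii) holds — by (ii) in each factor and `Σ_i(a_i − 1/e_i) ≤ 4·|I*|/p`.
[cite: Mochizuki2012, IUTchIV Prop. 1.4 (iii) p. 13] -/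
theorem Prop14iii₁_of_logPacket_volume [∀ i, MeasurableSpace (k i)] [∀ i, BorelSpace (k i)]
    (hscale : ∀ n : ℤ, packetLogVolume p k L ψ (ppow p k n • (logPacket p k : Set (PacketAlgebra p k)))
      = -(n * Real.log p) + packetLogVolume p k L ψ (logPacket p k : Set (PacketAlgebra p k)))
    (hident : packetLogVolume p k L ψ (logPacket p k : Set (PacketAlgebra p k))
      = (∑ i, normalizedLocalLogVolume (k i) (absRamificationIdx p (k i) * residueDegree p (k i))
            (logUnits (k i)))
          + packetLogVolume p k L ψ (integerPacket p k : Set (PacketAlgebra p k)))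
    (hRI : packetLogVolume p k L ψ (integerPacket p k : Set (PacketAlgebra p k)) ≤ 0) :
    Prop14iii₁ p k L ψ := by
  intro hI Istar htame i m
  have hp : p.Prime := Fact.out
  have h := logVolume_bound_one Finset.univ Istar (fun i ↦ absRamificationIdx p (k i)) hp
    (fun i _ ↦ absRamificationIdx_pos p (k i)) (Finset.subset_univ _) (fun i _ hi ↦ htame i hi)
    ((m : ℝ) / absRamificationIdx p (k i)) (dSum p k)
    (packetLogVolume p k L ψ (integerPacket p k : Set (PacketAlgebra p k)))
    (fun i ↦ normalizedLocalLogVolume (k i) (absRamificationIdx p (k i) * residueDegree p (k i))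
      (logUnits (k i)))
    (fun i _ ↦ normalizedLocalLogVolume_logUnits_le p (k i)) hRI
  have haSum : aSum p k = ∑ i, logRadiusA p (absRamificationIdx p (k i)) := rfl
  rw [hscale, hident, haSum]
  linarith

end FirstInequality

end Literature.IUT.LogVolume

end
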